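import Summits.AtomisticToContinuum.FouriersLaw.Theorems.EmbeddedDrudeMourreAbelThermodynamicLimitAnchoredCorrelationTailsLocalLipschitz

/-!
# Leaf (C) `stub_anchoredCorrelationTails`, part 2: common-noise propagation with distance-growing boxes
(crux `EmbeddedDrudeMourre.AbelThermodynamicLimit`, item stmt-AtomisticToContinuum-12596, line
`loomis-compact-horizon-witness`; `--supports` file proving the registered sub-goal `stub_coneWeightedPropagation`)

`N`-uniformity of the open-chain light cone at a FIXED distance `D` from the flipped site forbids a box `|q_j| ≤ R`
common to all `N` sites (its failure probability grows with `N`). With SITE-DEPENDENT radii growing with the distance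
to the flipped site `i₀`, `q_j(s)² ≤ R² max(1, |j - i₀|/D)` (`s ∈ [0,t]`, both flows), whose failure probability is
summable over `j ∈ ℤ` uniformly in `N` (part 4), Buttà–Marchioro's WEIGHTED Dobrushin–Fritz iteration
`BMLightCone.lattice_iteration_far` (weight `g(n) = max(1, n/D)`) and the local Lipschitz bound of part 1 still give,
at every site `k` with `|k - i₀| ≥ D`,

  `|δq_k(t)| + |δp_k(t)| ≤ 4 |p_{i₀}| 2^{-|k - i₀|}`     whenever `12 e · (2 A R²) · t ≤ D`,

`A = 3 + ω₂ + 3 lam + 24 β + 2γ` (`chainFlow_momentumFlip_propagation_weighted`, the weighted version of the tree's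
`LightConePropagation.chainFlow_momentumFlip_propagation_explicit`).
-/

noncomputable section

namespace Summit.AtomisticToContinuum.FouriersLaw.Theorems.AbelThermodynamicLimit.LoomisCompactHorizonWitness

open MeasureTheory Set Filter Topology
open Literature.MathematicalPhysics.KineticTheory.HeatConduction
open Summit.AtomisticToContinuum.FouriersLaw.Theorems.NonBallistic
open Summit.AtomisticToContinuum.FouriersLaw.Theorems.NonBallistic.LightConePropagation

variable {N : ℕ} {ω₂ lam β γ : ℝ}

/-! ### §1.3 The propagation bound with distance-growing radii -/

set_option maxHeartbeats 800000 in
/-- **Common-noise propagation bound with distance-growing box radii.** Two solutions of the Langevin integral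
equation of the pinned chain driven by the SAME continuous noise path, from `x` and from `x` with the momentum of site
`i₀` flipped, whose positions satisfy `q_j(s)² ≤ R² max(1, |j - i₀|/D)` on `[0, t]` (`R ≥ 1`, `D ≥ 1`), differ at every
site `k` with `|k - i₀| ≥ D` by at most `2 · 2|p_{i₀}| · 2^{-|k - i₀|}`, provided `12 e · (2 A R²) · t ≤ D`,
`A = 3 + ω₂ + 3 lam + 24 β + 2γ`. Proof: the site deviations `u_k = |δq_k| + |δp_k|` (extended by zero to `ℤ`) obey
`u_k(τ) ≤ u_k(0) + a g(|k - i₀|) ∫₀^τ (u_{k-1} + u_k + u_{k+1})` with `a = 2 A R²`, `g(n) = max(1, n/D)` (local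
Lipschitz bound on the box of radius `ρ_k = R √(2 g(|k - i₀|))` containing the positions at `k-1, k, k+1`), and
Buttà–Marchioro's weighted Dobrushin–Fritz iteration `BMLightCone.lattice_iteration_far` applies (in the regime,
`g(2n) = 2n/D` for `n ≥ D`). [folklore] -/
theorem chainFlow_momentumFlip_propagation_weighted (hω : 0 < ω₂) (hl : 0 ≤ lam) (hβ : 0 ≤ β) (hγ : 0 ≤ γ)
    (N : ℕ) (i₀ : Fin N) (x : PhaseSpace N) {η : ℝ → Fin N → ℝ} (hη : Continuous η) {R t : ℝ} {D : ℕ}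
    (hR : 1 ≤ R) (ht : 0 ≤ t) (hD : 1 ≤ D)
    (hbox : ∀ s ∈ Icc 0 t, ∀ j : Fin N,
      ((pinnedChain ω₂ lam β γ).chainFlow N x η s).1 j ^ 2 ≤
          R ^ 2 * max 1 ((((j : ℤ) - (i₀ : ℤ)).natAbs : ℝ) / D) ∧
      ((pinnedChain ω₂ lam β γ).chainFlow N (momentumFlip i₀ x) η s).1 j ^ 2 ≤
          R ^ 2 * max 1 ((((j : ℤ) - (i₀ : ℤ)).natAbs : ℝ) / D))
    (hreg : 12 * Real.exp 1 * (2 * ((3 + ω₂ + 3 * lam + 24 * β + 2 * γ) * R ^ 2)) * t ≤ D)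
    {k : Fin N} (hk : D ≤ ((k : ℤ) - (i₀ : ℤ)).natAbs) :
    |((pinnedChain ω₂ lam β γ).chainFlow N (momentumFlip i₀ x) η t).1 k -
        ((pinnedChain ω₂ lam β γ).chainFlow N x η t).1 k| +
      |((pinnedChain ω₂ lam β γ).chainFlow N (momentumFlip i₀ x) η t).2 k -
        ((pinnedChain ω₂ lam β γ).chainFlow N x η t).2 k| ≤
      2 * (2 * |x.2 i₀|) * (1 / 2) ^ ((k : ℤ) - (i₀ : ℤ)).natAbs := by
  -- adapted from `LightConePropagation.chainFlow_momentumFlip_propagation_explicit` (uniform box, weight `g ≡ 1`)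
  set g : ℕ → ℝ := fun n => max 1 ((n : ℝ) / D) with hgdef
  obtain ⟨hg1, hgm, hg3, hg4⟩ := coneWeight_props (D := D) hD
  have hg0 : ∀ n, 0 ≤ g n := fun n => zero_le_one.trans (hg1 n)
  have hD0 : (0 : ℝ) < D := by exact_mod_cast hD
  have hk' : 1 ≤ ((k : ℤ) - (i₀ : ℤ)).natAbs := hD.trans hk
  have hR0 : 0 ≤ R := zero_le_one.trans hR
  have hR2 : 1 ≤ R ^ 2 := one_le_pow₀ hR
  -- the two flows, the site deviations `v` and their lattice extension `u`
  set z : ℝ → PhaseSpace N := (pinnedChain ω₂ lam β γ).chainFlow N x η with hz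
  set z' : ℝ → PhaseSpace N := (pinnedChain ω₂ lam β γ).chainFlow N (momentumFlip i₀ x) η with hz'
  set v : Fin N → ℝ → ℝ := fun j s => |(z' s).1 j - (z s).1 j| + |(z' s).2 j - (z s).2 j| with hv
  set u : ℤ → ℝ → ℝ := fun l s => ∑ j : Fin N, if (j : ℤ) = l then v j s else 0 with hu
  have hu_coe : ∀ (j : Fin N) (s : ℝ), u j s = v j s := fun j s => latticeSum_coe (fun j => v j s) j
  have hv0 : ∀ j s, 0 ≤ v j s := fun j s => add_nonneg (abs_nonneg _) (abs_nonneg _)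
  have hu0 : ∀ l s, 0 ≤ u l s := fun l s => latticeSum_nonneg (fun j => hv0 j s) l
  have hd1 : ∀ (s : ℝ) (j : Fin N), |(z' s).1 j - (z s).1 j| ≤ u j s := fun s j => by
    rw [hu_coe]; exact le_add_of_nonneg_right (abs_nonneg _)
  have hd2 : ∀ (s : ℝ) (j : Fin N), |(z' s).2 j - (z s).2 j| ≤ u j s := fun s j => by
    rw [hu_coe]; exact le_add_of_nonneg_left (abs_nonneg _)
  -- continuity
  have hzc : Continuous z := pinnedChain_continuous_chainFlow hω hl hβ hγ N x hη
  have hz'c : Continuous z' := pinnedChain_continuous_chainFlow hω hl hβ hγ N (momentumFlip i₀ x) hη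
  have hYc : ∀ j, Continuous fun s => ((pinnedChain ω₂ lam β γ).drift N (z' s)).2 j -
      ((pinnedChain ω₂ lam β γ).drift N (z s)).2 j := fun j =>
    (pinnedChain_continuous_chainFlow_apply hω hl hβ hγ N (momentumFlip i₀ x) hη j).2.2.sub
      (pinnedChain_continuous_chainFlow_apply hω hl hβ hγ N x hη j).2.2
  have hvc : ∀ j, Continuous (v j) := fun j =>
    (((continuous_apply j).comp (continuous_fst.comp hz'c)).sub
        ((continuous_apply j).comp (continuous_fst.comp hzc))).abs.add
      (((continuous_apply j).comp (continuous_snd.comp hz'c)).sub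
        ((continuous_apply j).comp (continuous_snd.comp hzc))).abs
  have huc : ∀ l, Continuous (u l) := fun l => by
    refine continuous_finsetSum _ fun j _ => ?_
    split_ifs
    · exact hvc j
    · exact continuous_const
  -- the a priori bound on `[0, t]`
  obtain ⟨M, hM⟩ := (isCompact_Icc (a := (0 : ℝ)) (b := t)).exists_bound_of_continuousOn
    (hz'c.sub hzc).continuousOn
  set B : ℝ := 2 * max M 0 with hB
  have hB0 : 0 ≤ B := by positivity
  have hvB : ∀ j, ∀ s ∈ Icc 0 t, v j s ≤ B := by
    intro j s hs
    have hn : ‖z' s - z s‖ ≤ M := hM s hs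
    have h1 : |(z' s).1 j - (z s).1 j| ≤ M :=
      calc |(z' s).1 j - (z s).1 j| = ‖(z' s - z s).1 j‖ := by rw [Real.norm_eq_abs]; rfl
        _ ≤ ‖(z' s - z s).1‖ := norm_le_pi_norm _ j
        _ ≤ ‖z' s - z s‖ := norm_fst_le _
        _ ≤ M := hn
    have h2 : |(z' s).2 j - (z s).2 j| ≤ M :=
      calc |(z' s).2 j - (z s).2 j| = ‖(z' s - z s).2 j‖ := by rw [Real.norm_eq_abs]; rfl
        _ ≤ ‖(z' s - z s).2‖ := norm_le_pi_norm _ j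
        _ ≤ ‖z' s - z s‖ := norm_snd_le _
        _ ≤ M := hn
    calc v j s = |(z' s).1 j - (z s).1 j| + |(z' s).2 j - (z s).2 j| := rfl
      _ ≤ M + M := add_le_add h1 h2
      _ ≤ B := by rw [hB]; linarith [le_max_left M 0]
  have hu_bd : ∀ l, ∀ s ∈ Icc 0 t, u l s ≤ B * g (l - (i₀ : ℤ)).natAbs := fun l s hs =>
    (latticeSum_le hB0 (fun j => hvB j s hs) l).trans (le_mul_of_one_le_right hB0 (hg1 _))
  -- initial data: only the momentum of site `i₀` differs, by `2|p_{i₀}|`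
  have hz0 : z 0 = x + ((0 : Fin N → ℝ), η 0) := pinnedChain_chainFlow_of_nonpos ω₂ lam β γ N x hη le_rfl
  have hz'0 : z' 0 = momentumFlip i₀ x + ((0 : Fin N → ℝ), η 0) :=
    pinnedChain_chainFlow_of_nonpos ω₂ lam β γ N (momentumFlip i₀ x) hη le_rfl
  have hv_init : ∀ j, v j 0 = if j = i₀ then 2 * |x.2 i₀| else 0 := by
    intro j
    simp only [hv, hz0, hz'0, Prod.fst_add, Prod.snd_add, Pi.add_apply, momentumFlip_fst, sub_self,
      abs_zero, zero_add, add_sub_add_right_eq_sub]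
    by_cases hj : j = i₀
    · subst hj
      rw [if_pos rfl, momentumFlip_snd_self, show -x.2 j - x.2 j = -(2 * x.2 j) by ring, abs_neg, abs_mul,
        abs_two]
    · rw [if_neg hj, momentumFlip_snd_of_ne hj, sub_self, abs_zero]
  have hu_i : u i₀ 0 ≤ 2 * |x.2 i₀| := by rw [hu_coe, hv_init, if_pos rfl]
  have hu_0 : ∀ l, l ≠ (i₀ : ℤ) → u l 0 ≤ 0 := by
    intro l hl0
    refine le_of_eq (Finset.sum_eq_zero fun j _ => ?_)
    split_ifs with h
    · have hj : j ≠ i₀ := fun hji => hl0 (by rw [← h, hji])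
      rw [hv_init, if_neg hj]
    · rfl
  -- the rate
  set A : ℝ := 3 + ω₂ + 3 * lam + 24 * β + 2 * γ with hA
  set a : ℝ := 2 * (A * R ^ 2) with ha
  have hA0 : 0 ≤ A := by rw [hA]; positivity
  have ha0 : 0 ≤ a := by rw [ha]; positivity
  -- neighbouring sites have comparable weights: `g(|j' - i₀|) ≤ 2 g(|j - i₀|)` for `|j' - j| ≤ 1`
  have hgnb : ∀ j j' : Fin N, ((j' : ℤ) - (j : ℤ)).natAbs ≤ 1 →
      g ((j' : ℤ) - (i₀ : ℤ)).natAbs ≤ 2 * g ((j : ℤ) - (i₀ : ℤ)).natAbs := by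
    intro j j' hjj'
    have htri : ((j' : ℤ) - (i₀ : ℤ)).natAbs ≤ ((j : ℤ) - (i₀ : ℤ)).natAbs + 1 := by
      have := Int.natAbs_add_le ((j' : ℤ) - (j : ℤ)) ((j : ℤ) - (i₀ : ℤ))
      rw [show (j' : ℤ) - (j : ℤ) + ((j : ℤ) - (i₀ : ℤ)) = (j' : ℤ) - (i₀ : ℤ) by ring] at this
      omega
    have htri' : (((j' : ℤ) - (i₀ : ℤ)).natAbs : ℝ) ≤ ((j : ℤ) - (i₀ : ℤ)).natAbs + 1 := by
      exact_mod_cast htri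
    have hgj := hg1 ((j : ℤ) - (i₀ : ℤ)).natAbs
    simp only [hgdef] at hgj ⊢
    refine max_le (by linarith) ?_
    calc (((j' : ℤ) - (i₀ : ℤ)).natAbs : ℝ) / D ≤ ((((j : ℤ) - (i₀ : ℤ)).natAbs : ℝ) + 1) / D :=
          div_le_div_of_nonneg_right htri' hD0.le
      _ = (((j : ℤ) - (i₀ : ℤ)).natAbs : ℝ) / D + 1 / D := by ring
      _ ≤ max 1 ((((j : ℤ) - (i₀ : ℤ)).natAbs : ℝ) / D) + 1 := by
          refine add_le_add (le_max_right _ _) ?_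
          rw [div_le_one hD0]
          exact_mod_cast hD
      _ ≤ 2 * max 1 ((((j : ℤ) - (i₀ : ℤ)).natAbs : ℝ) / D) := by linarith
  -- the integral inequalities
  have hu_int : ∀ l, ∀ τ ∈ Icc 0 t, u l τ ≤ u l 0 +
      a * g (l - (i₀ : ℤ)).natAbs * ∫ s in (0 : ℝ)..τ, (u (l - 1) s + u l s + u (l + 1) s) := by
    intro l τ hτ
    have hW0 : ∀ s, 0 ≤ u (l - 1) s + u l s + u (l + 1) s := fun s =>
      add_nonneg (add_nonneg (hu0 _ s) (hu0 _ s)) (hu0 _ s)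
    have hWc : Continuous fun s => u (l - 1) s + u l s + u (l + 1) s := ((huc _).add (huc _)).add (huc _)
    have hI0 : 0 ≤ ∫ s in (0 : ℝ)..τ, (u (l - 1) s + u l s + u (l + 1) s) :=
      intervalIntegral.integral_nonneg hτ.1 fun s _ => hW0 s
    by_cases hex : ∃ j : Fin N, (j : ℤ) = l
    · obtain ⟨j, rfl⟩ := hex
      -- the local radius `ρ_j = R √(2 g(|j - i₀|))`
      set nj : ℕ := ((j : ℤ) - (i₀ : ℤ)).natAbs with hnj
      set ρ : ℝ := Real.sqrt (2 * R ^ 2 * g nj) with hρ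
      have hρarg : 0 ≤ 2 * R ^ 2 * g nj := by have := hg0 nj; positivity
      have hρ2 : ρ ^ 2 = 2 * R ^ 2 * g nj := Real.sq_sqrt hρarg
      have hρ0 : 0 ≤ ρ := Real.sqrt_nonneg _
      have hρ21 : 1 ≤ ρ ^ 2 := by
        rw [hρ2]
        have := hg1 nj
        nlinarith
      have hρ1 : 1 ≤ ρ := by nlinarith
      -- positions near `j` in the local box on `[0, t]`
      have hloc : ∀ s ∈ Icc 0 t, ∀ j' : Fin N, ((j' : ℤ) - (j : ℤ)).natAbs ≤ 1 →
          |(z s).1 j'| ≤ ρ ∧ |(z' s).1 j'| ≤ ρ := by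
        intro s hs j' hjj'
        have hw := hgnb j j' hjj'
        have hb := hbox s hs j'
        have hle : R ^ 2 * g ((j' : ℤ) - (i₀ : ℤ)).natAbs ≤ ρ ^ 2 := by
          rw [hρ2]
          nlinarith [hw, sq_nonneg R]
        exact ⟨(Real.abs_le_sqrt (hb.1.trans hle)).trans_eq (Real.sqrt_sq hρ0),
          (Real.abs_le_sqrt (hb.2.trans hle)).trans_eq (Real.sqrt_sq hρ0)⟩
      -- the local Lipschitz constant and the rate at `j`
      set L : ℝ := ω₂ + 3 * lam * ρ ^ 2 + 2 * (1 + 12 * β * ρ ^ 2) + 2 * γ with hL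
      have hKV0 : 0 ≤ 1 + 12 * β * ρ ^ 2 := by positivity
      have hKVL : 1 + 12 * β * ρ ^ 2 ≤ L := by rw [hL]; nlinarith
      have hL0 : 0 ≤ L := hKV0.trans hKVL
      have hLa : 1 + L ≤ a * g nj := by
        have e : a * g nj = A * ρ ^ 2 := by rw [ha, hρ2]; ring
        rw [e, hL, hA]
        nlinarith [mul_nonneg (show (0 : ℝ) ≤ 3 + ω₂ + 2 * γ by positivity) (show (0 : ℝ) ≤ ρ ^ 2 - 1 by linarith)]
      obtain ⟨hq, hp⟩ := pinnedChain_chainFlow_sub_apply hω hl hβ hγ N x (momentumFlip i₀ x) hη j hτ.1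
      have hδ0 : (z' 0).1 j - (z 0).1 j = (momentumFlip i₀ x).1 j - x.1 j ∧
          (z' 0).2 j - (z 0).2 j = (momentumFlip i₀ x).2 j - x.2 j := by
        rw [hz0, hz'0]
        simp only [Prod.fst_add, Prod.snd_add, Pi.add_apply, Pi.zero_apply, add_zero, add_sub_add_right_eq_sub,
          and_self]
      -- positions
      have h1 : |(z' τ).1 j - (z τ).1 j| ≤ |(z' 0).1 j - (z 0).1 j| +
          ∫ s in (0 : ℝ)..τ, (u (j - 1) s + u j s + u (j + 1) s) := by
        have hbd : |∫ s in (0 : ℝ)..τ, ((z' s).2 j - (z s).2 j)| ≤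
            ∫ s in (0 : ℝ)..τ, (u (j - 1) s + u j s + u (j + 1) s) := by
          refine (intervalIntegral.abs_integral_le_integral_abs hτ.1).trans ?_
          refine intervalIntegral.integral_mono_on hτ.1 ?_ (hWc.intervalIntegrable _ _) fun s _ => ?_
          · exact ((((continuous_apply j).comp (continuous_snd.comp hz'c)).sub
              ((continuous_apply j).comp (continuous_snd.comp hzc))).abs).intervalIntegrable _ _
          · have := hd2 s j
            linarith [hu0 ((j : ℤ) - 1) s, hu0 ((j : ℤ) + 1) s]
        have e : (z' τ).1 j - (z τ).1 j = ((z' 0).1 j - (z 0).1 j) +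
            ∫ s in (0 : ℝ)..τ, ((z' s).2 j - (z s).2 j) := by rw [hδ0.1]; exact hq
        rw [e]
        exact (abs_add_le _ _).trans (by linarith)
      -- momenta
      have h2 : |(z' τ).2 j - (z τ).2 j| ≤ |(z' 0).2 j - (z 0).2 j| +
          L * ∫ s in (0 : ℝ)..τ, (u (j - 1) s + u j s + u (j + 1) s) := by
        have hbd : |∫ s in (0 : ℝ)..τ, (((pinnedChain ω₂ lam β γ).drift N (z' s)).2 j -
              ((pinnedChain ω₂ lam β γ).drift N (z s)).2 j)| ≤
            ∫ s in (0 : ℝ)..τ, L * (u (j - 1) s + u j s + u (j + 1) s) := by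
          refine (intervalIntegral.abs_integral_le_integral_abs hτ.1).trans ?_
          refine intervalIntegral.integral_mono_on hτ.1 ((hYc j).abs.intervalIntegrable _ _)
            ((hWc.const_mul L).intervalIntegrable _ _) fun s hs => ?_
          have hst : s ∈ Icc 0 t := ⟨hs.1, hs.2.trans hτ.2⟩
          have hF := pinnedChain_abs_drift_snd_sub_le_local hω.le hl hβ hγ (z := z s) (z' := z' s) (ρ := ρ) j
            (fun j' hj' => (hloc s hst j' hj').1) (fun j' hj' => (hloc s hst j' hj').2) (d := fun l => u l s)
            (fun l => hu0 l s) (fun j' _ => hd1 s j') (hd2 s j)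
          refine hF.trans ?_
          rw [← hL]
          have hm := hu0 ((j : ℤ) - 1) s
          have hp' := hu0 ((j : ℤ) + 1) s
          nlinarith
        rw [intervalIntegral.integral_const_mul] at hbd
        have e : (z' τ).2 j - (z τ).2 j = ((z' 0).2 j - (z 0).2 j) +
            ∫ s in (0 : ℝ)..τ, (((pinnedChain ω₂ lam β γ).drift N (z' s)).2 j -
              ((pinnedChain ω₂ lam β γ).drift N (z s)).2 j) := by rw [hδ0.2]; exact hp
        rw [e]
        exact (abs_add_le _ _).trans (by linarith)
      -- combine
      rw [hu_coe, hu_coe]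
      calc v j τ = |(z' τ).1 j - (z τ).1 j| + |(z' τ).2 j - (z τ).2 j| := rfl
        _ ≤ (|(z' 0).1 j - (z 0).1 j| + |(z' 0).2 j - (z 0).2 j|) +
            (1 + L) * ∫ s in (0 : ℝ)..τ, (u (j - 1) s + u j s + u (j + 1) s) := by linarith
        _ ≤ v j 0 + a * g nj * ∫ s in (0 : ℝ)..τ, (u (j - 1) s + u j s + u (j + 1) s) :=
            add_le_add le_rfl (mul_le_mul_of_nonneg_right hLa hI0)
    · push Not at hex
      have hul : ∀ s, u l s = 0 := fun s => latticeSum_of_forall_ne (fun j => v j s) hex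
      rw [hul τ, hul 0, zero_add]
      exact mul_nonneg (mul_nonneg ha0 (hg0 _)) hI0
  -- the regime: for `n = |k - i₀| ≥ D`, `g(2n) = 2n/D` and `2e · 3a g(2n) t = 12 e a t · n/D ≤ n`
  set n : ℕ := ((k : ℤ) - (i₀ : ℤ)).natAbs with hn
  have hn0 : (0 : ℝ) < n := by exact_mod_cast hk'
  have hnD : (D : ℝ) ≤ n := by exact_mod_cast hk
  have hg2n : g (2 * n) = 2 * (n : ℝ) / D := by
    simp only [hgdef]
    push_cast
    refine max_eq_right ?_
    rw [le_div_iff₀ hD0]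
    linarith
  have hθ' : 2 * Real.exp 1 * (3 * a * g (2 * n) * t) ≤ n := by
    rw [hg2n]
    have e : 2 * Real.exp 1 * (3 * a * (2 * (n : ℝ) / D) * t) = (12 * Real.exp 1 * a * t) * n / D := by
      ring
    rw [e, div_le_iff₀ hD0]
    have hreg' : 12 * Real.exp 1 * a * t ≤ D := by rw [ha, hA]; linarith [hreg]
    nlinarith
  -- the Dobrushin–Fritz iteration with the weight `g`
  have hit := BMLightCone.lattice_iteration_far (g := g) (u := u) (i := (i₀ : ℤ)) (j := (k : ℤ))
    hg1 hgm hg3 hg4 ht (by positivity) ha0 hB0 (fun l => (huc l).continuousOn) hu_bd hu_i hu_0 hu_int hk' hθ'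
  rwa [hu_coe] at hit



/-- **Registered sub-goal `stub_coneWeightedPropagation`** (leaf (C) of S4, line `loomis-compact-horizon-witness`):
the common-noise propagation bound with distance-growing boxes (`chainFlow_momentumFlip_propagation_weighted`, closed
form). [folklore] -/
theorem stub_coneWeightedPropagation :
    ∀ ω₂ lam β γ : ℝ, 0 < ω₂ → 0 ≤ lam → 0 ≤ β → 0 ≤ γ →
      ∀ (N : ℕ) (i₀ : Fin N) (x : Literature.MathematicalPhysics.KineticTheory.HeatConduction.PhaseSpace N)
        (η : ℝ → Fin N → ℝ), Continuous η → ∀ (R t : ℝ) (D : ℕ), 1 ≤ R → 0 ≤ t → 1 ≤ D →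
        (∀ s ∈ Set.Icc 0 t, ∀ j : Fin N,
          ((Literature.MathematicalPhysics.KineticTheory.HeatConduction.pinnedChain ω₂ lam β γ).chainFlow N x η s).1 j ^ 2 ≤
              R ^ 2 * max 1 ((((j : ℤ) - (i₀ : ℤ)).natAbs : ℝ) / D) ∧
          ((Literature.MathematicalPhysics.KineticTheory.HeatConduction.pinnedChain ω₂ lam β γ).chainFlow N
              (Literature.MathematicalPhysics.KineticTheory.HeatConduction.momentumFlip i₀ x) η s).1 j ^ 2 ≤
              R ^ 2 * max 1 ((((j : ℤ) - (i₀ : ℤ)).natAbs : ℝ) / D)) →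
        12 * Real.exp 1 * (2 * ((3 + ω₂ + 3 * lam + 24 * β + 2 * γ) * R ^ 2)) * t ≤ D →
        ∀ k : Fin N, D ≤ ((k : ℤ) - (i₀ : ℤ)).natAbs →
          |((Literature.MathematicalPhysics.KineticTheory.HeatConduction.pinnedChain ω₂ lam β γ).chainFlow N
                (Literature.MathematicalPhysics.KineticTheory.HeatConduction.momentumFlip i₀ x) η t).1 k -
              ((Literature.MathematicalPhysics.KineticTheory.HeatConduction.pinnedChain ω₂ lam β γ).chainFlow N x η t).1 k| +
            |((Literature.MathematicalPhysics.KineticTheory.HeatConduction.pinnedChain ω₂ lam β γ).chainFlow N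
                (Literature.MathematicalPhysics.KineticTheory.HeatConduction.momentumFlip i₀ x) η t).2 k -
              ((Literature.MathematicalPhysics.KineticTheory.HeatConduction.pinnedChain ω₂ lam β γ).chainFlow N x η t).2 k| ≤
            2 * (2 * |x.2 i₀|) * (1 / 2) ^ ((k : ℤ) - (i₀ : ℤ)).natAbs :=
  fun _ _ _ _ hω hl hβ hγ N i₀ x _ hη _ _ _ hR ht hD hbox hreg _ hk =>
    chainFlow_momentumFlip_propagation_weighted hω hl hβ hγ N i₀ x hη hR ht hD hbox hreg hk

end Summit.AtomisticToContinuum.FouriersLaw.Theorems.AbelThermodynamicLimit.LoomisCompactHorizonWitness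

end
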